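import Summits.QuantumFields.YangMills.Theorems.BalabanUVNodesN15KingModelFineBlockFieldLaw
import Mathlib.Analysis.Calculus.ParametricIntegral

/-!
# BalabanUVNodes ∕ N15 — THE KING-MODEL RUNG (PART Ϝ-s): THE MOMENTS OF THE GAUSSIAN LAW `ρ_A dx` BY DIFFERENTIATION UNDER THE INTEGRAL SIGN —
# `∫⟨J,x⟩ρ_A = 0`, `∫⟨J,x⟩²ρ_A = ⟨J,A⁻¹J⟩`, `∫⟨J,x⟩⁴ρ_A = 3⟨J,A⁻¹J⟩²`, `∫ x_i x_j ρ_A = (A⁻¹)_{ij}` — AND THE BLOCK TWO-POINT FUNCTION AS THE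
# COVARIANCE OF THE LAW OF THE BLOCK AVERAGES OF THE FINE FREE FIELD: `∫ φ(x)φ(y) ρ_{(S₂^{(K)})⁻¹}(φ)dφ = S₂^{(K)}(x,y)`, `Var⟨J,φ⟩ = 2 ln Z_{ε_K}(Ω, J∘blk)`
# (Track A, DAG node N15 = NE2; FAN-OUT v1.1 §N15 s3 «KING-MODEL RUNG»; uses parts Τ-a (tilt identity), Τ-b, Ϝ-a, Ϝ-d, Ϝ-q, Ϝ-r; count-neutral)

HONEST FRAMING.  Count-neutral (cell `pub-ymgap`, seat `pub-ymgap-dag-n15-e` g33; `--supports stmt-QuantumFields-27366 --as helper` = K3⁸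
`SpineGivenEndpointR13SepCoPHV`).  Folklore finite-dimensional Gaussian calculus for the DENSITY-defined law `ρ_A(x)dx = e^{−½⟨x,Ax⟩}dx∕𝒩(A)` of a symmetric
coercive precision `A` on `ℝ^ι` ([King1986] (C. King, Commun. Math. Phys. **102** (1986) 649–677) (2.6) p.652 — the shape of every measure of the paper),
proved DIRECTLY from part Τ-a's determinant-free tilt identity `∫e^{⟨J,x⟩}ρ_A = e^{½⟨J,A⁻¹J⟩}` by differentiating `t ↦ ∫⟨J,x⟩ⁿe^{t⟨J,x⟩}ρ_A` under the
integral sign (Mathlib's `hasDerivAt_integral_of_dominated_loc_of_deriv_le` with the majorant `|sⁿe^{ts}| ≤ e^{(R+n)s} + e^{−(R+n)s}` on `|t| ≤ R`) and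
`HasDerivAt.unique`.  NEAREST PRIOR ART IN THE TREE (searched by name): `Literature…CurvatureGaussianField` ∕ `…B3WTFreeMeasure` prove moments and Wick's
theorem for the KOLMOGOROV-built measure `gaussianFieldOfKernel K`, and Mathlib's `multivariateGaussian` carries its covariance — none of them is the
density-defined law used by parts Τ∕Ϡ∕Ϝ, and the tree holds no theorem identifying the two; this file does not identify them either (it computes the
moments of `ρ_A dx` on their own).  KING APPLICATION (`A = 0`, `g = 0` free covariance model, unit torus `𝕋_M`, fine torus `T_{1∕N}`, `N = L^K`): with
part Ϝ-r's precision `P_K = (S₂^{(K)})⁻¹` of the block averages of the fine free field, ★★★ `∫ φ(x)φ(y) ρ_{P_K}(φ)dφ = S₂^{(K)}(x,y)` — part Ϝ-d's block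
two-point function `kingS2` IS the covariance of the block-field law — its `K = ∞` twin with `kingS2Lim`, the variance functional
`∫⟨J,φ⟩²ρ_{P_K} = 2 ln Z_{ε_K}(Ω, J∘blk)` (part Ϝ-a's fine-lattice generating functional at block-constant sources), mean zero, and the convergence of all
second moments as `K → ∞` (an UNBOUNDED observable — not covered by part Ϝ-r's total-variation statement).  Nothing Bałaban ∕ continuum-Yang–Mills ∕ `ℝ⁴` ∕
OS ∕ mass-gap ∕ Clay; N15 is booked through n15-a's knit, untouched here.  0 `sorry`, 0 def; standard axioms.

WHAT THIS FILE PROVES (kernel).  §1 majorants `abs_le_exp_abs`, `exp_mul_abs_le`, ★ `abs_pow_mul_exp_le`; §2 `continuous_∕integrable_pow_mul_exp_mul_gaussDensity`,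
`integrable_exp_add_exp_mul_gaussDensity`, ★★ **`hasDerivAt_momentLine`**; §3 closed forms `momentLine_zero_eq` (Τ-a), ★ `momentLine_one_eq`
(`tQe^{½t²Q}`), ★ `momentLine_two_eq` (`(Q+t²Q²)e^{½t²Q}`), `momentLine_three_eq` (`(3tQ²+t³Q³)e^{½t²Q}`), hence ★★ `integral_dot_gaussDensity = 0`,
★★★ **`integral_dot_sq_gaussDensity = ⟨J,A⁻¹J⟩`**, `integral_dot_pow_three_gaussDensity = 0`, ★★ `integral_dot_pow_four_gaussDensity = 3⟨J,A⁻¹J⟩²` (Isserlis on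
a line); §4 ★★★ **`integral_dot_mul_dot_gaussDensity = ⟨J,A⁻¹J′⟩`** (polarization), ★★ `integral_eval_mul_gaussDensity : ∫x_ix_jρ_A = (A⁻¹)_{ij}`,
`integral_eval_gaussDensity = 0`; §5 KING: `fineBlockPrec_inv`, `fineBlockPrecLim_inv`, ★★★ **`integral_eval_mul_fineBlockLaw`**, ★★★ `integral_eval_mul_fineBlockLawLim`,
★★ `integral_dot_sq_fineBlockLaw`, ★★ **`integral_dot_sq_fineBlockLaw_eq_two_mul_log_kingFineZ`**, `integral_eval_fineBlockLaw`, ★★ `tendsto_integral_eval_mul_fineBlockLaw`.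
-/

noncomputable section

open scoped BigOperators
open Finset Matrix Filter Topology MeasureTheory

namespace Summit.QuantumFields.YangMills.BalabanUVNodes.N15KingModelRung.FreeField

open Literature.MathematicalPhysics.QuantumFieldTheory.Balaban1983to89.QGQInverse (Coercive isUnit_of_coercive)

variable {ι : Type*} [Fintype ι] [DecidableEq ι]

/-! ## §1 Elementary majorants for differentiation under the integral sign -/

section Majorants

/-- `|s| ≤ e^{|s|}`. [folklore] -/
theorem abs_le_exp_abs (s : ℝ) : |s| ≤ Real.exp |s| := by
  have h := Real.add_one_le_exp |s|
  linarith

/-- `e^{c|s|} ≤ e^{cs} + e^{−cs}`. [folklore] -/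
theorem exp_mul_abs_le (c s : ℝ) : Real.exp (c * |s|) ≤ Real.exp (c * s) + Real.exp (-(c * s)) := by
  rcases le_total 0 s with h | h
  · rw [abs_of_nonneg h]; linarith [Real.exp_pos (-(c * s))]
  · rw [abs_of_nonpos h, mul_neg]; linarith [Real.exp_pos (c * s)]

/-- ★ The majorant: for `|t| ≤ R`, `|sⁿ·e^{ts}| ≤ e^{(R+n)s} + e^{−(R+n)s}` (`|s|ⁿ ≤ e^{n|s|}`, `e^{ts} ≤ e^{R|s|}`). [folklore] -/
theorem abs_pow_mul_exp_le (n : ℕ) {t R : ℝ} (ht : |t| ≤ R) (s : ℝ) :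
    |s ^ n * Real.exp (t * s)| ≤ Real.exp ((R + n) * s) + Real.exp (-((R + n) * s)) := by
  rw [abs_mul, abs_of_pos (Real.exp_pos _), abs_pow]
  have h1 : |s| ^ n ≤ Real.exp ((n : ℝ) * |s|) := by
    rw [Real.exp_nat_mul]
    exact pow_le_pow_left₀ (abs_nonneg s) (abs_le_exp_abs s) n
  have h2 : Real.exp (t * s) ≤ Real.exp (R * |s|) := Real.exp_le_exp.mpr (by
    calc t * s ≤ |t * s| := le_abs_self _
      _ = |t| * |s| := abs_mul t s
      _ ≤ R * |s| := mul_le_mul_of_nonneg_right ht (abs_nonneg s))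
  calc |s| ^ n * Real.exp (t * s) ≤ Real.exp ((n : ℝ) * |s|) * Real.exp (R * |s|) :=
        mul_le_mul h1 h2 (Real.exp_pos _).le (Real.exp_pos _).le
    _ = Real.exp ((R + n) * |s|) := by rw [← Real.exp_add]; ring_nf
    _ ≤ _ := exp_mul_abs_le _ _

end Majorants

/-! ## §2 The line-moment functions `t ↦ ∫⟨J,x⟩ⁿe^{t⟨J,x⟩}ρ_A` are differentiable under the integral sign -/

section LineMoments

variable {A : Matrix ι ι ℝ} {δ : ℝ}

omit [DecidableEq ι] in
/-- `x ↦ ⟨J,x⟩ⁿe^{t⟨J,x⟩}ρ_A(x)` is continuous. [folklore] -/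
theorem continuous_pow_mul_exp_mul_gaussDensity (A : Matrix ι ι ℝ) (J : ι → ℝ) (n : ℕ) (t : ℝ) :
    Continuous fun x : ι → ℝ => (J ⬝ᵥ x) ^ n * Real.exp (t * (J ⬝ᵥ x)) * gaussDensity A x := by
  have hJ : Continuous fun x : ι → ℝ => J ⬝ᵥ x := by simp only [dotProduct]; fun_prop
  exact ((hJ.pow n).mul (Real.continuous_exp.comp (continuous_const.mul hJ))).mul (continuous_gaussDensity A)

omit [DecidableEq ι] in
/-- `(e^{c⟨J,x⟩} + e^{−c⟨J,x⟩})ρ_A` is integrable (two tilts of part Τ-a). [folklore] -/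
theorem integrable_exp_add_exp_mul_gaussDensity (hδ : 0 < δ) (hA : Coercive A δ) (J : ι → ℝ) (c : ℝ) :
    Integrable fun x : ι → ℝ => (Real.exp (c * (J ⬝ᵥ x)) + Real.exp (-(c * (J ⬝ᵥ x)))) * gaussDensity A x := by
  have h1 : Integrable (fun x : ι → ℝ => Real.exp ((c • J) ⬝ᵥ x) * gaussDensity A x) :=
    integrable_exp_dot_gaussDensity hδ hA (c • J)
  have h2 : Integrable (fun x : ι → ℝ => Real.exp ((-(c • J)) ⬝ᵥ x) * gaussDensity A x) :=
    integrable_exp_dot_gaussDensity hδ hA (-(c • J))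
  refine (h1.add h2).congr (Eventually.of_forall fun x => ?_)
  simp only [Pi.add_apply, smul_dotProduct, neg_dotProduct, smul_eq_mul]
  ring

omit [DecidableEq ι] in
/-- `⟨J,x⟩ⁿe^{t⟨J,x⟩}ρ_A` is integrable (majorant `abs_pow_mul_exp_le` with `R = |t|`). [folklore] -/
theorem integrable_pow_mul_exp_mul_gaussDensity (hδ : 0 < δ) (hA : Coercive A δ) (J : ι → ℝ) (n : ℕ) (t : ℝ) :
    Integrable fun x : ι → ℝ => (J ⬝ᵥ x) ^ n * Real.exp (t * (J ⬝ᵥ x)) * gaussDensity A x := by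
  refine (integrable_exp_add_exp_mul_gaussDensity hδ hA J (|t| + n)).mono'
    (continuous_pow_mul_exp_mul_gaussDensity A J n t).aestronglyMeasurable (Eventually.of_forall fun x => ?_)
  have h0 : 0 ≤ gaussDensity A x := gaussDensity_nonneg hδ hA x
  rw [Real.norm_eq_abs, abs_mul, abs_of_nonneg h0]
  exact mul_le_mul_of_nonneg_right (abs_pow_mul_exp_le n (le_refl |t|) (J ⬝ᵥ x)) h0

omit [DecidableEq ι] in
/-- ★★ **DIFFERENTIATION UNDER THE INTEGRAL SIGN ALONG A LINE**: `t ↦ ∫⟨J,x⟩ⁿe^{t⟨J,x⟩}ρ_A(x)dx` has derivative `∫⟨J,x⟩ⁿ⁺¹e^{t₀⟨J,x⟩}ρ_A(x)dx` at every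
`t₀` (dominated by `(e^{(|t₀|+n+2)⟨J,x⟩} + e^{−(|t₀|+n+2)⟨J,x⟩})ρ_A` on the ball `|t − t₀| < 1`). [folklore] -/
theorem hasDerivAt_momentLine (hδ : 0 < δ) (hA : Coercive A δ) (J : ι → ℝ) (n : ℕ) (t₀ : ℝ) :
    HasDerivAt (fun t => ∫ x : ι → ℝ, (J ⬝ᵥ x) ^ n * Real.exp (t * (J ⬝ᵥ x)) * gaussDensity A x)
      (∫ x : ι → ℝ, (J ⬝ᵥ x) ^ (n + 1) * Real.exp (t₀ * (J ⬝ᵥ x)) * gaussDensity A x) t₀ := by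
  have key := hasDerivAt_integral_of_dominated_loc_of_deriv_le (μ := (volume : Measure (ι → ℝ))) (x₀ := t₀)
    (F := fun t x => (J ⬝ᵥ x) ^ n * Real.exp (t * (J ⬝ᵥ x)) * gaussDensity A x)
    (F' := fun t x => (J ⬝ᵥ x) ^ (n + 1) * Real.exp (t * (J ⬝ᵥ x)) * gaussDensity A x)
    (bound := fun x => (Real.exp ((|t₀| + 1 + ↑(n + 1)) * (J ⬝ᵥ x)) + Real.exp (-((|t₀| + 1 + ↑(n + 1)) * (J ⬝ᵥ x))))
      * gaussDensity A x)
    (Metric.ball_mem_nhds t₀ zero_lt_one)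
    (Eventually.of_forall fun t => (continuous_pow_mul_exp_mul_gaussDensity A J n t).aestronglyMeasurable)
    (integrable_pow_mul_exp_mul_gaussDensity hδ hA J n t₀)
    (continuous_pow_mul_exp_mul_gaussDensity A J (n + 1) t₀).aestronglyMeasurable ?_
    (integrable_exp_add_exp_mul_gaussDensity hδ hA J _) ?_
  · exact key.2
  · refine Eventually.of_forall fun x t ht => ?_
    have ht' : |t| ≤ |t₀| + 1 := by
      have h := Metric.mem_ball.mp ht
      rw [Real.dist_eq] at h
      have h' := abs_sub_abs_le_abs_sub t t₀
      linarith
    have h0 : 0 ≤ gaussDensity A x := gaussDensity_nonneg hδ hA x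
    rw [Real.norm_eq_abs, abs_mul, abs_of_nonneg h0]
    exact mul_le_mul_of_nonneg_right (abs_pow_mul_exp_le (n + 1) ht' (J ⬝ᵥ x)) h0
  · refine Eventually.of_forall fun x t _ => ?_
    have h : HasDerivAt (fun t => (J ⬝ᵥ x) ^ n * Real.exp (t * (J ⬝ᵥ x)) * gaussDensity A x)
        ((J ⬝ᵥ x) ^ n * (Real.exp (t * (J ⬝ᵥ x)) * (1 * (J ⬝ᵥ x))) * gaussDensity A x) t :=
      ((((hasDerivAt_id t).mul_const (J ⬝ᵥ x)).exp.const_mul ((J ⬝ᵥ x) ^ n)).mul_const (gaussDensity A x))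
    have hv : (J ⬝ᵥ x) ^ n * (Real.exp (t * (J ⬝ᵥ x)) * (1 * (J ⬝ᵥ x))) * gaussDensity A x
        = (J ⬝ᵥ x) ^ (n + 1) * Real.exp (t * (J ⬝ᵥ x)) * gaussDensity A x := by ring
    rw [hv] at h
    exact h

end LineMoments

/-! ## §3 Closed forms by uniqueness of the derivative against part Τ-a's MGF, and the moments -/

section Moments

variable {A : Matrix ι ι ℝ} {δ : ℝ}

/-- `n = 0` (part Τ-a's tilt identity along the line): `∫e^{t⟨J,x⟩}ρ_A = e^{½t²⟨J,A⁻¹J⟩}`. [folklore] -/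
theorem momentLine_zero_eq (hδ : 0 < δ) (hA : Coercive A δ) (hsymm : Aᵀ = A) (J : ι → ℝ) (t : ℝ) :
    ∫ x : ι → ℝ, (J ⬝ᵥ x) ^ 0 * Real.exp (t * (J ⬝ᵥ x)) * gaussDensity A x
      = Real.exp ((1 / 2 : ℝ) * t ^ 2 * (J ⬝ᵥ (A⁻¹ *ᵥ J))) := by
  have h : ∫ x : ι → ℝ, Real.exp ((t • J) ⬝ᵥ x) * gaussDensity A x
      = Real.exp ((1 / 2 : ℝ) * ((t • J) ⬝ᵥ (A⁻¹ *ᵥ (t • J)))) := integral_exp_dot_gaussDensity hδ hA hsymm (t • J)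
  rw [quad_inv_smul, ← mul_assoc] at h
  rw [← h]
  refine integral_congr_ae (Eventually.of_forall fun x => ?_)
  simp only [pow_zero, one_mul, smul_dotProduct, smul_eq_mul]

/-- ★ `n = 1`: `∫⟨J,x⟩e^{t⟨J,x⟩}ρ_A = tQe^{½t²Q}`, `Q = ⟨J,A⁻¹J⟩`. [folklore] -/
theorem momentLine_one_eq (hδ : 0 < δ) (hA : Coercive A δ) (hsymm : Aᵀ = A) (J : ι → ℝ) (t : ℝ) :
    ∫ x : ι → ℝ, (J ⬝ᵥ x) ^ 1 * Real.exp (t * (J ⬝ᵥ x)) * gaussDensity A x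
      = t * (J ⬝ᵥ (A⁻¹ *ᵥ J)) * Real.exp ((1 / 2 : ℝ) * t ^ 2 * (J ⬝ᵥ (A⁻¹ *ᵥ J))) := by
  have h1 := hasDerivAt_momentLine hδ hA J 0 t
  have e : (fun t => ∫ x : ι → ℝ, (J ⬝ᵥ x) ^ 0 * Real.exp (t * (J ⬝ᵥ x)) * gaussDensity A x)
      = fun t => Real.exp ((1 / 2 : ℝ) * t ^ 2 * (J ⬝ᵥ (A⁻¹ *ᵥ J))) := funext fun t => momentLine_zero_eq hδ hA hsymm J t
  rw [e, zero_add] at h1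
  have h2 := (((hasDerivAt_pow 2 t).const_mul (1 / 2 : ℝ)).mul_const (J ⬝ᵥ (A⁻¹ *ᵥ J))).exp
  rw [h1.unique h2, show (2 : ℕ) - 1 = 1 from rfl, pow_one, Nat.cast_ofNat]
  ring

/-- ★ `n = 2`: `∫⟨J,x⟩²e^{t⟨J,x⟩}ρ_A = (Q + t²Q²)e^{½t²Q}`. [folklore] -/
theorem momentLine_two_eq (hδ : 0 < δ) (hA : Coercive A δ) (hsymm : Aᵀ = A) (J : ι → ℝ) (t : ℝ) :
    ∫ x : ι → ℝ, (J ⬝ᵥ x) ^ 2 * Real.exp (t * (J ⬝ᵥ x)) * gaussDensity A x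
      = ((J ⬝ᵥ (A⁻¹ *ᵥ J)) + t ^ 2 * (J ⬝ᵥ (A⁻¹ *ᵥ J)) ^ 2) * Real.exp ((1 / 2 : ℝ) * t ^ 2 * (J ⬝ᵥ (A⁻¹ *ᵥ J))) := by
  have h1 := hasDerivAt_momentLine hδ hA J 1 t
  have e : (fun t => ∫ x : ι → ℝ, (J ⬝ᵥ x) ^ 1 * Real.exp (t * (J ⬝ᵥ x)) * gaussDensity A x)
      = fun t => t * (J ⬝ᵥ (A⁻¹ *ᵥ J)) * Real.exp ((1 / 2 : ℝ) * t ^ 2 * (J ⬝ᵥ (A⁻¹ *ᵥ J))) :=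
    funext fun t => momentLine_one_eq hδ hA hsymm J t
  rw [e, one_add_one_eq_two] at h1
  have h2 := ((hasDerivAt_id t).mul_const (J ⬝ᵥ (A⁻¹ *ᵥ J))).mul
    (((hasDerivAt_pow 2 t).const_mul (1 / 2 : ℝ)).mul_const (J ⬝ᵥ (A⁻¹ *ᵥ J))).exp
  rw [h1.unique h2, show (2 : ℕ) - 1 = 1 from rfl, pow_one, Nat.cast_ofNat, id_eq]
  ring

/-- `n = 3`: `∫⟨J,x⟩³e^{t⟨J,x⟩}ρ_A = (3tQ² + t³Q³)e^{½t²Q}`. [folklore] -/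
theorem momentLine_three_eq (hδ : 0 < δ) (hA : Coercive A δ) (hsymm : Aᵀ = A) (J : ι → ℝ) (t : ℝ) :
    ∫ x : ι → ℝ, (J ⬝ᵥ x) ^ 3 * Real.exp (t * (J ⬝ᵥ x)) * gaussDensity A x
      = (3 * t * (J ⬝ᵥ (A⁻¹ *ᵥ J)) ^ 2 + t ^ 3 * (J ⬝ᵥ (A⁻¹ *ᵥ J)) ^ 3)
          * Real.exp ((1 / 2 : ℝ) * t ^ 2 * (J ⬝ᵥ (A⁻¹ *ᵥ J))) := by
  have h1 := hasDerivAt_momentLine hδ hA J 2 t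
  have e : (fun t => ∫ x : ι → ℝ, (J ⬝ᵥ x) ^ 2 * Real.exp (t * (J ⬝ᵥ x)) * gaussDensity A x)
      = fun t => ((J ⬝ᵥ (A⁻¹ *ᵥ J)) + t ^ 2 * (J ⬝ᵥ (A⁻¹ *ᵥ J)) ^ 2) * Real.exp ((1 / 2 : ℝ) * t ^ 2 * (J ⬝ᵥ (A⁻¹ *ᵥ J))) :=
    funext fun t => momentLine_two_eq hδ hA hsymm J t
  rw [e, show (2 : ℕ) + 1 = 3 from rfl] at h1
  have h2 := (((hasDerivAt_pow 2 t).mul_const ((J ⬝ᵥ (A⁻¹ *ᵥ J)) ^ 2)).const_add (J ⬝ᵥ (A⁻¹ *ᵥ J))).mul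
    (((hasDerivAt_pow 2 t).const_mul (1 / 2 : ℝ)).mul_const (J ⬝ᵥ (A⁻¹ *ᵥ J))).exp
  rw [h1.unique h2, show (2 : ℕ) - 1 = 1 from rfl, pow_one, Nat.cast_ofNat]
  ring

/-- ★★ **MEAN ZERO**: `∫⟨J,x⟩ρ_A(x)dx = 0`. [folklore] -/
theorem integral_dot_gaussDensity (hδ : 0 < δ) (hA : Coercive A δ) (hsymm : Aᵀ = A) (J : ι → ℝ) :
    ∫ x : ι → ℝ, (J ⬝ᵥ x) * gaussDensity A x = 0 := by
  have h := momentLine_one_eq hδ hA hsymm J 0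
  simp only [pow_one, zero_mul, Real.exp_zero, mul_one] at h
  exact h

/-- ★★★ **THE SECOND MOMENT IS THE INVERSE PRECISION**: `∫⟨J,x⟩²ρ_A(x)dx = ⟨J, A⁻¹J⟩`. [cite: King1986, (2.6) p.652, (2.23) p.654] -/
theorem integral_dot_sq_gaussDensity (hδ : 0 < δ) (hA : Coercive A δ) (hsymm : Aᵀ = A) (J : ι → ℝ) :
    ∫ x : ι → ℝ, (J ⬝ᵥ x) ^ 2 * gaussDensity A x = J ⬝ᵥ (A⁻¹ *ᵥ J) := by
  have h := momentLine_two_eq hδ hA hsymm J 0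
  norm_num at h
  simpa using h

/-- The third moment vanishes: `∫⟨J,x⟩³ρ_A = 0`. [folklore] -/
theorem integral_dot_pow_three_gaussDensity (hδ : 0 < δ) (hA : Coercive A δ) (hsymm : Aᵀ = A) (J : ι → ℝ) :
    ∫ x : ι → ℝ, (J ⬝ᵥ x) ^ 3 * gaussDensity A x = 0 := by
  have h := momentLine_three_eq hδ hA hsymm J 0
  simp only [zero_mul, mul_zero, Real.exp_zero, mul_one, zero_add] at h
  rw [h]
  ring

/-- ★★ **ISSERLIS ON A LINE**: `∫⟨J,x⟩⁴ρ_A = 3⟨J,A⁻¹J⟩²` (three pairings). [folklore] -/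
theorem integral_dot_pow_four_gaussDensity (hδ : 0 < δ) (hA : Coercive A δ) (hsymm : Aᵀ = A) (J : ι → ℝ) :
    ∫ x : ι → ℝ, (J ⬝ᵥ x) ^ 4 * gaussDensity A x = 3 * (J ⬝ᵥ (A⁻¹ *ᵥ J)) ^ 2 := by
  have h1 := hasDerivAt_momentLine hδ hA J 3 0
  have e : (fun t => ∫ x : ι → ℝ, (J ⬝ᵥ x) ^ 3 * Real.exp (t * (J ⬝ᵥ x)) * gaussDensity A x)
      = fun t => (3 * t * (J ⬝ᵥ (A⁻¹ *ᵥ J)) ^ 2 + t ^ 3 * (J ⬝ᵥ (A⁻¹ *ᵥ J)) ^ 3)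
          * Real.exp ((1 / 2 : ℝ) * t ^ 2 * (J ⬝ᵥ (A⁻¹ *ᵥ J))) :=
    funext fun t => momentLine_three_eq hδ hA hsymm J t
  rw [e, show (3 : ℕ) + 1 = 4 from rfl] at h1
  simp only [zero_mul, Real.exp_zero, mul_one] at h1
  have h2 := ((((hasDerivAt_id (0 : ℝ)).const_mul 3).mul_const ((J ⬝ᵥ (A⁻¹ *ᵥ J)) ^ 2)).add
    ((hasDerivAt_pow 3 (0 : ℝ)).mul_const ((J ⬝ᵥ (A⁻¹ *ᵥ J)) ^ 3))).mul
    (((hasDerivAt_pow 2 (0 : ℝ)).const_mul (1 / 2 : ℝ)).mul_const (J ⬝ᵥ (A⁻¹ *ᵥ J))).exp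
  rw [h1.unique h2]
  norm_num

end Moments

/-! ## §4 Polarization: the covariance matrix of `ρ_A dx` is `A⁻¹` -/

section Covariance

variable {A : Matrix ι ι ℝ} {δ : ℝ}

omit [DecidableEq ι] in
/-- `⟨a, Sb⟩ = ⟨b, Sa⟩` for symmetric `S`. [folklore] -/
theorem dot_mulVec_comm_of_transpose_eq {S : Matrix ι ι ℝ} (hS : Sᵀ = S) (a b : ι → ℝ) : a ⬝ᵥ (S *ᵥ b) = b ⬝ᵥ (S *ᵥ a) := by
  rw [Matrix.dotProduct_mulVec, ← Matrix.mulVec_transpose, hS, dotProduct_comm]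

/-- `(A⁻¹)ᵀ = A⁻¹` for symmetric `A`. [folklore] -/
theorem transpose_inv_of_transpose_eq (hsymm : Aᵀ = A) : (A⁻¹)ᵀ = A⁻¹ := by
  rw [Matrix.transpose_nonsing_inv, hsymm]

omit [DecidableEq ι] in
/-- `⟨J,x⟩²ρ_A` is integrable. [folklore] -/
theorem integrable_dot_sq_gaussDensity (hδ : 0 < δ) (hA : Coercive A δ) (J : ι → ℝ) :
    Integrable fun x : ι → ℝ => (J ⬝ᵥ x) ^ 2 * gaussDensity A x := by
  refine (integrable_pow_mul_exp_mul_gaussDensity hδ hA J 2 0).congr (Eventually.of_forall fun x => ?_)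
  simp only [zero_mul, Real.exp_zero, mul_one]

/-- ★★★ **THE COVARIANCE OF `ρ_A dx` IS `A⁻¹`**: `∫⟨J,x⟩⟨J′,x⟩ρ_A(x)dx = ⟨J, A⁻¹J′⟩` (polarization of `integral_dot_sq_gaussDensity`).
[cite: King1986, (2.6) p.652, (2.23) p.654] -/
theorem integral_dot_mul_dot_gaussDensity (hδ : 0 < δ) (hA : Coercive A δ) (hsymm : Aᵀ = A) (J J' : ι → ℝ) :
    ∫ x : ι → ℝ, (J ⬝ᵥ x) * (J' ⬝ᵥ x) * gaussDensity A x = J ⬝ᵥ (A⁻¹ *ᵥ J') := by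
  have i1 := integral_dot_sq_gaussDensity hδ hA hsymm J
  have i2 := integral_dot_sq_gaussDensity hδ hA hsymm J'
  have i3 := integral_dot_sq_gaussDensity hδ hA hsymm (J + J')
  have hint : ∀ K : ι → ℝ, Integrable fun x : ι → ℝ => (K ⬝ᵥ x) ^ 2 * gaussDensity A x :=
    fun K => integrable_dot_sq_gaussDensity hδ hA K
  have e : ∀ x : ι → ℝ, (J ⬝ᵥ x) * (J' ⬝ᵥ x) * gaussDensity A x
      = (1 / 2 : ℝ) * (((J + J') ⬝ᵥ x) ^ 2 * gaussDensity A x) - (1 / 2 : ℝ) * ((J ⬝ᵥ x) ^ 2 * gaussDensity A x)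
          - (1 / 2 : ℝ) * ((J' ⬝ᵥ x) ^ 2 * gaussDensity A x) := by
    intro x; rw [add_dotProduct]; ring
  simp_rw [e]
  rw [integral_sub, integral_sub, integral_const_mul, integral_const_mul, integral_const_mul,
    i1, i2, i3, add_dotProduct, Matrix.mulVec_add, dotProduct_add, dotProduct_add,
    dot_mulVec_comm_of_transpose_eq (transpose_inv_of_transpose_eq hsymm) J' J]
  all_goals first
    | exact (((hint (J + J')).const_mul _).sub ((hint J).const_mul _))
    | exact (hint (J + J')).const_mul _
    | exact (hint J).const_mul _
    | exact (hint J').const_mul _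
    | ring

/-- ★★ **ENTRYWISE**: `∫ x_i x_j ρ_A(x)dx = (A⁻¹)_{ij}`. [cite: King1986, (2.6) p.652, (2.23) p.654] -/
theorem integral_eval_mul_gaussDensity (hδ : 0 < δ) (hA : Coercive A δ) (hsymm : Aᵀ = A) (i j : ι) :
    ∫ x : ι → ℝ, x i * x j * gaussDensity A x = A⁻¹ i j := by
  have h := integral_dot_mul_dot_gaussDensity hδ hA hsymm (Pi.single i 1) (Pi.single j 1)
  simp_rw [single_one_dotProduct, Matrix.mulVec_single_one] at h
  exact h

/-- `∫ x_i ρ_A(x)dx = 0`. [folklore] -/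
theorem integral_eval_gaussDensity (hδ : 0 < δ) (hA : Coercive A δ) (hsymm : Aᵀ = A) (i : ι) :
    ∫ x : ι → ℝ, x i * gaussDensity A x = 0 := by
  have h := integral_dot_gaussDensity hδ hA hsymm (Pi.single i 1)
  simp_rw [single_one_dotProduct] at h
  exact h

/-- `∫ x_i² ρ_A(x)dx = (A⁻¹)_{ii}`. [folklore] -/
theorem integral_eval_sq_gaussDensity (hδ : 0 < δ) (hA : Coercive A δ) (hsymm : Aᵀ = A) (i : ι) :
    ∫ x : ι → ℝ, x i ^ 2 * gaussDensity A x = A⁻¹ i i := by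
  rw [← integral_eval_mul_gaussDensity hδ hA hsymm i i]
  refine integral_congr_ae (Eventually.of_forall fun x => ?_)
  simp only [sq]

end Covariance

end Summit.QuantumFields.YangMills.BalabanUVNodes.N15KingModelRung.FreeField

/-! ## §5 KING: the block two-point function is the covariance of the law of the block averages of the fine free field -/

namespace Summit.QuantumFields.YangMills.BalabanUVNodes.N15KingModelRung

open Literature.MathematicalPhysics.QuantumFieldTheory.Balaban1983to89.B5Prop11Plancherel (Tor)
open Literature.MathematicalPhysics.QuantumFieldTheory.Balaban1983to89.QGQInverse (Coercive isUnit_of_coercive)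
open FreeField

section King

variable {d : ℕ} (L : ℕ) (M : Fin (d + 1) → ℕ) [hM : ∀ ν, NeZero (M ν)]

/-- `P_K⁻¹ = S₂^{(K)}` (the precision of part Ϝ-r is the inverse of an invertible matrix). [cite: King1986, (2.13) p.653] -/
theorem fineBlockPrec_inv (N : ℕ) [NeZero N] {m2 : ℝ} (hm : 0 < m2) : (fineBlockPrec M N m2)⁻¹ = Matrix.of (kingS2 N M m2) := by
  unfold fineBlockPrec
  exact Matrix.nonsing_inv_nonsing_inv _
    ((Matrix.isUnit_iff_isUnit_det _).mp (isUnit_of_coercive (s2Floor_pos hm) (coercive_kingS2 M N hm)))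

/-- `P_∞⁻¹ = S₂^{(∞)}`. [cite: King1986, (2.13) p.653] -/
theorem fineBlockPrecLim_inv (hLodd : Odd L) (hL : 2 ≤ L) {m2 : ℝ} (hm : 0 < m2) : (fineBlockPrecLim M m2)⁻¹ = Matrix.of (kingS2Lim M m2) := by
  unfold fineBlockPrecLim
  exact Matrix.nonsing_inv_nonsing_inv _
    ((Matrix.isUnit_iff_isUnit_det _).mp (isUnit_of_coercive (s2Floor_pos hm) (coercive_kingS2Lim L M hLodd hL hm)))

/-- ★★★ **THE BLOCK TWO-POINT FUNCTION IS THE COVARIANCE OF THE BLOCK-FIELD LAW**: `∫ φ(x)φ(y) ρ_{P_K}(φ)dφ = S₂^{(K)}(x,y)` for the law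
`ρ_{P_K}dφ`, `P_K = (S₂^{(K)})⁻¹`, of the block averages of the fine free field (`A = 0`, `g = 0`). [cite: King1986, (2.6) p.652, (2.13) p.653, (2.23) p.654] -/
theorem integral_eval_mul_fineBlockLaw (N : ℕ) [NeZero N] {m2 : ℝ} (hm : 0 < m2) (x y : Tor M) :
    ∫ φ : Tor M → ℝ, φ x * φ y * gaussDensity (fineBlockPrec M N m2) φ = kingS2 N M m2 x y := by
  rw [integral_eval_mul_gaussDensity hm (coercive_fineBlockPrec M N hm) (fineBlockPrec_transpose M N m2), fineBlockPrec_inv M N hm,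
    Matrix.of_apply]

/-- ★★★ **THE `K = ∞` TWIN**: `∫ φ(x)φ(y) ρ_{P_∞}(φ)dφ = S₂^{(∞)}(x,y)`. [cite: King1986, (2.6) p.652, Thm 2.1 (2.23) p.654] -/
theorem integral_eval_mul_fineBlockLawLim (hLodd : Odd L) (hL : 2 ≤ L) {m2 : ℝ} (hm : 0 < m2) (x y : Tor M) :
    ∫ φ : Tor M → ℝ, φ x * φ y * gaussDensity (fineBlockPrecLim M m2) φ = kingS2Lim M m2 x y := by
  rw [integral_eval_mul_gaussDensity hm (coercive_fineBlockPrecLim L M hLodd hL hm) (fineBlockPrecLim_transpose M m2),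
    fineBlockPrecLim_inv L M hLodd hL hm, Matrix.of_apply]

/-- ★★ **SMEARED**: `∫⟨J,φ⟩²ρ_{P_K}(φ)dφ = ⟨J, S₂^{(K)}J⟩`. [cite: King1986, (2.13) p.653, (2.23) p.654] -/
theorem integral_dot_sq_fineBlockLaw (N : ℕ) [NeZero N] {m2 : ℝ} (hm : 0 < m2) (J : Tor M → ℝ) :
    ∫ φ : Tor M → ℝ, (J ⬝ᵥ φ) ^ 2 * gaussDensity (fineBlockPrec M N m2) φ = J ⬝ᵥ (Matrix.of (kingS2 N M m2) *ᵥ J) := by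
  rw [integral_dot_sq_gaussDensity hm (coercive_fineBlockPrec M N hm) (fineBlockPrec_transpose M N m2), fineBlockPrec_inv M N hm]

/-- ★★ **THE VARIANCE FUNCTIONAL IS KING's GENERATING FUNCTIONAL**: `∫⟨J,φ⟩²ρ_{P_K}(φ)dφ = 2·ln Z_{ε_K}(Ω, J∘blk)` (part Ϝ-a's fine-lattice functional at
the block-constant source; part Ϝ-r's `mgf_fineBlockLaw_eq_kingFineZ`). [cite: King1986, (2.4)–(2.6) p.652, Thm 2.1 (2.22)–(2.23) p.654] -/
theorem integral_dot_sq_fineBlockLaw_eq_two_mul_log_kingFineZ (N : ℕ) [NeZero N] {m2 : ℝ} (hm : 0 < m2) (J : Tor M → ℝ) :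
    ∫ φ : Tor M → ℝ, (J ⬝ᵥ φ) ^ 2 * gaussDensity (fineBlockPrec M N m2) φ = 2 * Real.log (kingFineZ N M m2 (blockSrc N M J)) := by
  have h : ∫ x : Tor M → ℝ, Real.exp (J ⬝ᵥ x) * gaussDensity (fineBlockPrec M N m2) x
      = Real.exp ((1 / 2 : ℝ) * (J ⬝ᵥ ((fineBlockPrec M N m2)⁻¹ *ᵥ J))) :=
    integral_exp_dot_gaussDensity hm (coercive_fineBlockPrec M N hm) (fineBlockPrec_transpose M N m2) J
  rw [← mgf_fineBlockLaw_eq_kingFineZ M N hm J, h, Real.log_exp, integral_dot_sq_fineBlockLaw M N hm J, fineBlockPrec_inv M N hm]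
  ring

/-- Mean zero: `∫ φ(x) ρ_{P_K}(φ)dφ = 0`. [folklore] -/
theorem integral_eval_fineBlockLaw (N : ℕ) [NeZero N] {m2 : ℝ} (hm : 0 < m2) (x : Tor M) :
    ∫ φ : Tor M → ℝ, φ x * gaussDensity (fineBlockPrec M N m2) φ = 0 :=
  integral_eval_gaussDensity hm (coercive_fineBlockPrec M N hm) (fineBlockPrec_transpose M N m2) x

/-- ★★ **ALL SECOND MOMENTS CONVERGE** (`K → ∞`; an unbounded observable, by the closed forms and part Ϝ-d's `tendsto_kingS2`).
[cite: King1986, Thm 2.1 (2.23) p.654] -/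
theorem tendsto_integral_eval_mul_fineBlockLaw (hLodd : Odd L) (hL : 2 ≤ L) {m2 : ℝ} (hm : 0 < m2) (x y : Tor M) :
    haveI : NeZero L := ⟨by omega⟩
    Tendsto (fun K : ℕ => ∫ φ : Tor M → ℝ, φ x * φ y * gaussDensity (fineBlockPrec M (L ^ K) m2) φ) atTop
      (𝓝 (∫ φ : Tor M → ℝ, φ x * φ y * gaussDensity (fineBlockPrecLim M m2) φ)) := by
  haveI : NeZero L := ⟨by omega⟩
  have e : (fun K : ℕ => ∫ φ : Tor M → ℝ, φ x * φ y * gaussDensity (fineBlockPrec M (L ^ K) m2) φ) = fun K => kingS2 (L ^ K) M m2 x y :=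
    funext fun K => integral_eval_mul_fineBlockLaw M (L ^ K) hm x y
  rw [e, integral_eval_mul_fineBlockLawLim L M hLodd hL hm x y]
  exact tendsto_kingS2 L M hLodd hL hm x y

end King

end Summit.QuantumFields.YangMills.BalabanUVNodes.N15KingModelRung

end
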